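import Literature.Topology.FourManifolds.MorseRearrangementProofs
import HarnessLib

/-!
# The whole-cobordism forms of Milnor's Thms. 4.1–4.2 and 4.4 from their slab forms

Topic `Literature/Topology/FourManifolds` (fact seat
`provefact-Literature.SPC4.isTrivial_of_isHCobordism_of_five_le`; fact-inventory hygiene requested
in the review of `MorseRearrangement.lean`).  `HandleSpheres.lean` states Milnor's
Thm. 4.1 with its Extension 4.2 and Thm. 4.4 for a whole cobordism `(W; M, N)` as the named
facts `Literature.Topology.FourManifolds.Cobordism.Milnor1965_preliminaryRearrangement` and
`Literature.Topology.FourManifolds.Cobordism.Milnor1965_exists_isGradientLike_disjoint_spheres`; the later files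
`HCobordismTradeStep.lean` and `MorseRearrangementProofs.lean` state the same theorems applied
to a slab `f⁻¹[a₀, a₁]` (`Literature.Topology.FourManifolds.Cobordism.Milnor1965_rearrangement_slab`,
`Literature.Topology.FourManifolds.Cobordism.Milnor1965_exists_isGradientLike_disjoint_spheres_slab`), which is how Milnor
uses them (PDF pp. 25, 54–57).  Everything here is **proved**: the whole-cobordism forms
follow from the slab forms (take a slab containing all critical values and the target
levels), so that only the two slab forms remain as named facts of §4.

## References

* J. Milnor, *Lectures on the h-cobordism theorem* (1965), Thms. 4.1, 4.2 (PDF pp. 22–23),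
  Thm. 4.4 (PDF pp. 23–25). [MilnorHCobordism1965]
-/

open Set Function Filter
open scoped Manifold Topology ContDiff

noncomputable section

namespace Literature.Topology.FourManifolds

universe u

namespace Cobordism

/-- **Thm. 4.1–4.2 for a whole cobordism from Thm. 4.1–4.2 on a slab**: the named fact
`Literature.Topology.FourManifolds.Cobordism.Milnor1965_preliminaryRearrangement` (`HandleSpheres.lean`) follows from
`Literature.Topology.FourManifolds.Cobordism.Milnor1965_rearrangement_slab` (`HCobordismTradeStep.lean`) applied to a slab
`f⁻¹[a₀, a₁]`, `0 < a₀ < a₁ < 1`, containing the two critical levels and the two target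
levels (the boundary `∂W = f⁻¹{0, 1}` lies in `{f ∉ (a₀, a₁)}`, near which the new function
is `f`). [cite: MilnorHCobordism1965, Thms. 4.1, 4.2 (PDF pp. 22–23)] -/
theorem Milnor1965_preliminaryRearrangement_of_slab (h412 : Milnor1965_rearrangement_slab.{u}) :
    Milnor1965_preliminaryRearrangement.{u} := by
  intro n M N _ _ _ _ _ _ _ _ _ _ _ _ c f hf ξ hξ P P' hPne hP'ne hPP' hcrit b b' hPb hP'b' hK
    a a' ha ha'
  -- the critical levels `b`, `b'` lie in `(0, 1)`
  have hval : ∀ z ∈ criticalSet (𝓡∂ (n + 1)) f, f z ∈ Ioo 0 1 := by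
    intro z hz
    have hint : z ∈ (𝓡∂ (n + 1)).interior c.W := by
      by_contra hb
      have : z ∈ (𝓡∂ (n + 1)).boundary c.W := by
        rw [← ModelWithCorners.compl_interior]; exact hb
      exact hf.2.2.2.1 z this hz
    exact hf.2.2.2.2 z hint
  obtain ⟨p₀, hp₀⟩ := hPne
  obtain ⟨p₁, hp₁⟩ := hP'ne
  have hb : b ∈ Ioo (0 : ℝ) 1 := by
    rw [← hPb p₀ hp₀]; exact hval p₀ (by rw [hcrit]; exact Or.inl hp₀)
  have hb' : b' ∈ Ioo (0 : ℝ) 1 := by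
    rw [← hP'b' p₁ hp₁]; exact hval p₁ (by rw [hcrit]; exact Or.inr hp₁)
  -- the slab
  set m := min (min a a') (min b b') with hm
  set m' := max (max a a') (max b b') with hm'
  have hm0 : 0 < m := lt_min (lt_min ha.1 ha'.1) (lt_min hb.1 hb'.1)
  have hm'1 : m' < 1 := max_lt (max_lt ha.2 ha'.2) (max_lt hb.2 hb'.2)
  set a₀ := m / 2 with ha₀
  set a₁ := (m' + 1) / 2 with ha₁
  have ha₀0 : 0 < a₀ := by rw [ha₀]; linarith
  have ha₀m : a₀ < m := by rw [ha₀]; linarith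
  have hm'a₁ : m' < a₁ := by rw [ha₁]; linarith
  have ha₁1 : a₁ < 1 := by rw [ha₁]; linarith
  have hmem : ∀ x, m ≤ x → x ≤ m' → x ∈ Ioo a₀ a₁ := fun x h1 h2 =>
    ⟨ha₀m.trans_le h1, h2.trans_lt hm'a₁⟩
  have hamem : a ∈ Ioo a₀ a₁ :=
    hmem a ((min_le_left _ _).trans (min_le_left _ _)) ((le_max_left _ _).trans' (le_max_left _ _))
  have ha'mem : a' ∈ Ioo a₀ a₁ :=
    hmem a' ((min_le_left _ _).trans (min_le_right _ _))
      ((le_max_left _ _).trans' (le_max_right _ _))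
  have hbmem : b ∈ Ioo a₀ a₁ :=
    hmem b ((min_le_right _ _).trans (min_le_left _ _))
      ((le_max_right _ _).trans' (le_max_left _ _))
  have hb'mem : b' ∈ Ioo a₀ a₁ :=
    hmem b' ((min_le_right _ _).trans (min_le_right _ _))
      ((le_max_right _ _).trans' (le_max_right _ _))
  have ha₀a₁ : a₀ < a₁ := hamem.1.trans hamem.2
  obtain ⟨g, hg, hgξ, hcritg, hgP, hgP', hnear, -, hnearP, hnearP'⟩ := h412 hf ξ hξ ha₀0 ha₀a₁
    ha₁1 ⟨p₀, hp₀⟩ ⟨p₁, hp₁⟩ hPP' (by rw [hcrit]) (fun z hz _ => by rw [hcrit] at hz; exact hz)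
    hbmem hb'mem hPb hP'b' hK hamem ha'mem
  refine ⟨g, hg, hgξ, by rw [hcritg, hcrit], hgP, hgP', ?_, hnearP, hnearP'⟩
  -- the boundary lies in `{f ∉ (a₀, a₁)}`
  refine hnear.filter_mono (nhdsSet_mono fun z hz => ?_)
  rw [← c.range_inl_union_range_inr] at hz
  rcases hz with ⟨x, rfl⟩ | ⟨y, rfl⟩
  · show f (c.inl x) ∉ Ioo a₀ a₁
    rw [hf.2.1 x]; exact fun h => lt_irrefl _ (ha₀0.trans h.1)
  · show f (c.inr y) ∉ Ioo a₀ a₁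
    rw [hf.2.2.1 y]; exact fun h => lt_irrefl _ (h.2.trans ha₁1)

/-- **Thm. 4.4 for a whole cobordism from Thm. 4.4 on a slab**: the named fact
`Literature.Topology.FourManifolds.Cobordism.Milnor1965_exists_isGradientLike_disjoint_spheres` (`HandleSpheres.lean`)
follows from `Literature.Topology.FourManifolds.Cobordism.Milnor1965_exists_isGradientLike_disjoint_spheres_slab`
(`MorseRearrangementProofs.lean`) applied to the slab `f⁻¹[-1, 2] = W`.
[cite: MilnorHCobordism1965, Thm. 4.4 (PDF pp. 23–25)] -/
theorem Milnor1965_exists_isGradientLike_disjoint_spheres_of_slab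
    (h44 : Milnor1965_exists_isGradientLike_disjoint_spheres_slab.{u}) :
    Milnor1965_exists_isGradientLike_disjoint_spheres.{u} := by
  intro n M N _ _ _ _ _ _ _ _ _ _ _ _ c f hf ξ hξ P P' hcrit b hPb hP'b k k' hk'k hPk hP'k' U hU
  have h01 : ∀ z, f z ∈ Icc (0 : ℝ) 1 := fun z => hf.mem_Icc z
  by_cases hne : P.Nonempty ∧ P'.Nonempty
  · obtain ⟨⟨p₀, hp₀⟩, ⟨p₁, hp₁⟩⟩ := hne
    have hb0 : (-1 : ℝ) < b := by linarith [(h01 p₀).1, hPb p₀ hp₀]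
    have hb1 : b < 2 := by linarith [(h01 p₁).2, hP'b p₁ hp₁]
    exact h44 hf ξ hξ hb0 hb1 (by rw [hcrit]) (fun z hz _ => by rw [hcrit] at hz; exact hz)
      (fun p hp => ⟨by linarith [(h01 p).1], hPb p hp⟩)
      (fun p hp => ⟨hP'b p hp, by linarith [(h01 p).2]⟩) hk'k hPk hP'k' hU
  · -- one of the two families of spheres is empty: nothing to separate
    refine ⟨ξ, hξ, fun _ _ => rfl, fun p hp p' hp' => ?_⟩
    exact absurd ⟨⟨p, hp⟩, ⟨p', hp'⟩⟩ hne

end Cobordism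

end Literature.Topology.FourManifolds
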